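import Summits.Ventures.PercRepro.C025ProfileGenRule
import Summits.Ventures.PercRepro.C025ProfileRankFourCapD
import Summits.Ventures.PercRepro.C025ProfileRankFourCapCB

/-!
# The general certificate: the geometry in rank ≥ 4, and (Cap)(d) (night-3 g8)

NIGHT3-G8-GENERAL-CERTIFICATE.md §1, §3(d) for the rule `wgn` on a simple matroid of rank `≥ 4`:
* (F4′) `j(B) = 2 ⇒ ρ(E∖B) = ρ(E)` (`eRank_le_crk_of_jB_eq_two`, `four_le_crk_of_jB_eq_two`); the rank-`4` facts
  `two_le_crk_of_mem_clF_notMem` / `three_le_crk_of_two_mem_clF_notMem` with `4 ≤ ρ(E)` in place of `ρ(E) = 4`;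
* (Cap)(d) `cap_wgn_of_five_le_card`: only `B = S ∖ {y}` pays, at most `2` (`p ≤ r + 1`; `j = 1 ⇒ r ≥ 2`; `j = 2 ⇒ r ≥ 3`).
(Cap)(a) and (b) are in `C025ProfileGenCapAB`.
-/

open scoped Matroid

namespace PercRepro

open Set Finset ThmH

section GenGeom

variable {α : Type} [DecidableEq α] {M : Matroid α} [M.Finite]

/-- **(F4′)**: in a simple matroid, `j(B) = 2` forces `ρ(E ∖ B) ≥ ρ(E)` (so `= ρ(E)`): the complement spans two
points of the line of `B`, hence the line, hence `B`, hence `E`. -/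
theorem eRank_le_crk_of_jB_eq_two (hsimple : ∀ T ⊆ M.E, T.encard ≤ 2 → M.Indep T) {B : Finset α}
    (hB : B ∈ Profile.Rq M 2) (hj : jB M B = 2) : M.eRank ≤ (crk M B : ℕ∞) := by
  rw [Profile.mem_Rq] at hB
  obtain ⟨hBg, hB2⟩ := hB
  have hc : 2 ≤ (clF M B \ B).card := by
    unfold jB at hj
    rw [Finset.card_sdiff_of_subset (subset_clF_self hBg)]
    omega
  obtain ⟨U, hUT, hUc⟩ := Finset.exists_subset_card_eq hc
  obtain ⟨u, u', huu', hU⟩ := Finset.card_eq_two.1 hUc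
  have hu : u ∈ clF M B \ B := hUT (by rw [hU]; exact Finset.mem_insert_self _ _)
  have hu' : u' ∈ clF M B \ B := hUT (by rw [hU]; exact Finset.mem_insert_of_mem (Finset.mem_singleton_self _))
  have hline : ((clF M B : Finset α) : Set α) ⊆ M.closure ((gr M \ B : Finset α) : Set α) :=
    clF_subset_closure_of_two_mem hsimple hB2 huu' (Finset.mem_sdiff.1 hu).1 (Finset.mem_sdiff.1 hu').1
      (by rw [Finset.mem_coe, Finset.mem_sdiff]; exact ⟨clF_subset_gr B (Finset.mem_sdiff.1 hu).1, (Finset.mem_sdiff.1 hu).2⟩)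
      (by rw [Finset.mem_coe, Finset.mem_sdiff]; exact ⟨clF_subset_gr B (Finset.mem_sdiff.1 hu').1, (Finset.mem_sdiff.1 hu').2⟩)
  have hEsub : M.E ⊆ M.closure ((gr M \ B : Finset α) : Set α) := by
    intro x hx
    by_cases hxB : x ∈ B
    · exact hline (subset_clF_self hBg hxB)
    · apply M.subset_closure _ (by rw [Finset.coe_sdiff, coe_gr]; exact Set.sdiff_subset)
      rw [Finset.mem_coe, Finset.mem_sdiff]
      exact ⟨by rw [← Finset.mem_coe, coe_gr]; exact hx, hxB⟩
  calc M.eRank = M.eRk M.E := M.eRank_def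
    _ ≤ M.eRk (M.closure ((gr M \ B : Finset α) : Set α)) := M.eRk_mono hEsub
    _ = M.eRk ((gr M \ B : Finset α) : Set α) := M.eRk_closure_eq _
    _ = (crk M B : ℕ∞) := eRk_gr_sdiff_eq_crk B

/-- In a simple matroid of rank `≥ 4`, `j(B) = 2` forces `ρ(E∖B) ≥ 4`. -/
theorem four_le_crk_of_jB_eq_two (hR : (4 : ℕ∞) ≤ M.eRank) (hsimple : ∀ T ⊆ M.E, T.encard ≤ 2 → M.Indep T)
    {B : Finset α} (hB : B ∈ Profile.Rq M 2) (hj : jB M B = 2) : 4 ≤ crk M B := by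
  have := hR.trans (eRank_le_crk_of_jB_eq_two hsimple hB hj)
  exact_mod_cast this

/-- A point of the line `cl B` outside `S ⊆ cl B ∪ {u}` forces `ρ(E∖S) ≥ 2` (rank `≥ 4`, simple). -/
theorem two_le_crk_of_mem_clF_notMem' (hR : (4 : ℕ∞) ≤ M.eRank) (hsimple : ∀ T ⊆ M.E, T.encard ≤ 2 → M.Indep T)
    {B S : Finset α} {u : α} (hB2 : M.eRk (B : Set α) = 2) (hsub : S ⊆ insert u (clF M B)) {z : α}
    (hz : z ∈ clF M B) (hzS : z ∉ S) : 2 ≤ crk M S := by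
  by_contra hr
  push Not at hr
  have hr1 : M.eRk ((gr M \ S : Finset α) : Set α) ≤ 1 := by
    rw [eRk_gr_sdiff_eq_crk]; exact_mod_cast Nat.lt_succ_iff.1 hr
  have hc1 := card_le_one_of_eRk_le_one hsimple Finset.sdiff_subset hr1
  have hzES : z ∈ gr M \ S := Finset.mem_sdiff.2 ⟨clF_subset_gr B hz, hzS⟩
  have hsub' : gr M ⊆ insert u (clF M B) := by
    intro x hx
    by_cases hxS : x ∈ S
    · exact hsub hxS
    · have : x = z := Finset.card_le_one.1 hc1 x (Finset.mem_sdiff.2 ⟨hx, hxS⟩) z hzES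
      rw [this]; exact Finset.mem_insert_of_mem hz
  have : M.eRk ((gr M : Finset α) : Set α) ≤ 3 := by
    calc M.eRk ((gr M : Finset α) : Set α) ≤ M.eRk ((insert u (clF M B) : Finset α) : Set α) :=
          M.eRk_mono (Finset.coe_subset.2 hsub')
      _ ≤ M.eRk ((clF M B : Finset α) : Set α) + 1 := by
          rw [Finset.coe_insert]; exact M.eRk_insert_le_add_one _ _
      _ = 3 := by rw [eRk_clF_of_eRk_two hB2]; rfl
  rw [eRk_gr_eq_eRank] at this
  have := hR.trans this
  exact absurd this (by decide)

/-- Two points of the line `cl B` outside `S ⊆ cl B ∪ {u}` force `ρ(E∖S) ≥ 3` (rank `≥ 4`, simple). -/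
theorem three_le_crk_of_two_mem_clF_notMem' (hR : (4 : ℕ∞) ≤ M.eRank) (hsimple : ∀ T ⊆ M.E, T.encard ≤ 2 → M.Indep T)
    {B S : Finset α} {u : α} (hB2 : M.eRk (B : Set α) = 2) (hsub : S ⊆ insert u (clF M B)) {z z' : α}
    (hzz' : z ≠ z') (hz : z ∈ clF M B) (hz' : z' ∈ clF M B) (hzS : z ∉ S) (hz'S : z' ∉ S) : 3 ≤ crk M S := by
  by_contra hr
  push Not at hr
  have hr2 : M.eRk ((gr M \ S : Finset α) : Set α) ≤ 2 := by
    rw [eRk_gr_sdiff_eq_crk]; exact_mod_cast Nat.lt_succ_iff.1 hr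
  have hzES : z ∈ gr M \ S := Finset.mem_sdiff.2 ⟨clF_subset_gr B hz, hzS⟩
  have hz'ES : z' ∈ gr M \ S := Finset.mem_sdiff.2 ⟨clF_subset_gr B hz', hz'S⟩
  have hline : ((clF M B : Finset α) : Set α) ⊆ M.closure ((gr M \ S : Finset α) : Set α) :=
    clF_subset_closure_of_two_mem hsimple hB2 hzz' hz hz' (by exact_mod_cast hzES) (by exact_mod_cast hz'ES)
  have hsub' : ((gr M : Finset α) : Set α) ⊆ insert u (M.closure ((gr M \ S : Finset α) : Set α)) := by
    intro x hx
    rw [Finset.mem_coe] at hx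
    rw [Set.mem_insert_iff]
    by_cases hxS : x ∈ S
    · have := hsub hxS
      rw [Finset.mem_insert] at this
      rcases this with h | h
      · exact Or.inl h
      · exact Or.inr (hline h)
    · right
      exact M.subset_closure _ (by rw [Finset.coe_sdiff, coe_gr]; exact Set.sdiff_subset)
        (by rw [Finset.mem_coe]; exact Finset.mem_sdiff.2 ⟨hx, hxS⟩)
  have : M.eRk ((gr M : Finset α) : Set α) ≤ 3 := by
    calc M.eRk ((gr M : Finset α) : Set α)
        ≤ M.eRk (insert u (M.closure ((gr M \ S : Finset α) : Set α))) := M.eRk_mono hsub'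
      _ ≤ M.eRk (M.closure ((gr M \ S : Finset α) : Set α)) + 1 := M.eRk_insert_le_add_one _ _
      _ ≤ 2 + 1 := by rw [M.eRk_closure_eq]; exact add_le_add_left hr2 _
      _ = 3 := by norm_num
  rw [eRk_gr_eq_eRank] at this
  have := hR.trans this
  exact absurd this (by decide)

/-- **(Cap)(d), the weight bound in every rank `≥ 4`**: a rank-`2` set `B = S ∖ {y}` of a rank-`3` set `S` with
`|B| ≥ 3` is paid at most `2` by `wgn`. -/
theorem wgn_le_two_of_sdiff_singleton (hR : (4 : ℕ∞) ≤ M.eRank) (hsimple : ∀ T ⊆ M.E, T.encard ≤ 2 → M.Indep T)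
    {S B : Finset α} (hS : S ∈ Shadow.levelSet M 3) (hB : B ∈ Profile.Rq M 2) (hBS : B ⊆ S) (hB3 : 3 ≤ B.card)
    {y : α} (hy : S \ B = {y}) : wgn M B S ≤ 2 := by
  classical
  have hS3 : M.eRk (S : Set α) = 3 := (Profile.mem_levelSet.1 hS).2
  rw [Profile.mem_Rq] at hB
  obtain ⟨hBg, hB2⟩ := hB
  have hyS : y ∈ S := by
    have : y ∈ S \ B := by rw [hy]; exact Finset.mem_singleton_self y
    exact (Finset.mem_sdiff.1 this).1
  have hSeq : S = insert y B := by
    ext x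
    rw [Finset.mem_insert]
    constructor
    · intro hx
      by_cases hxB : x ∈ B
      · exact Or.inr hxB
      · left
        have : x ∈ S \ B := Finset.mem_sdiff.2 ⟨hx, hxB⟩
        rw [hy] at this
        exact Finset.mem_singleton.1 this
    · rintro (rfl | hx)
      · exact hyS
      · exact hBS hx
  by_cases hp3 : crk M B < 3
  · rw [wgn_eq_zero_of_crk_lt_three hp3]; norm_num
  push Not at hp3
  have hpr : crk M B ≤ crk M S + 1 := crk_le_crk_add_one_of_sdiff_singleton hy
  have hsd : (S \ B).card = 1 := by rw [hy, Finset.card_singleton]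
  unfold wgn
  rw [wg_of_sdiff_card_one_of_three_le_card hsd hB3 hp3]
  have hprq : (crk M B : ℚ) ≤ (crk M S : ℚ) + 1 := by exact_mod_cast hpr
  have hj2 : jB M B ≤ 2 := by unfold jB; exact min_le_left _ _
  -- y is not on the line of B
  have hyL : y ∉ clF M B := notMem_clF_of_insert_eRk_three hBg hB2 (by rw [← hSeq]; exact hS3)
  have hsub : S ⊆ insert y (clF M B) := by
    rw [hSeq]; exact Finset.insert_subset_insert _ (subset_clF_self hBg)
  have hLS : ∀ z ∈ clF M B \ B, z ∉ S := by
    intro z hz hzS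
    rw [hSeq, Finset.mem_insert] at hzS
    rcases hzS with rfl | h
    · exact hyL (Finset.mem_sdiff.1 hz).1
    · exact (Finset.mem_sdiff.1 hz).2 h
  have hcard : (clF M B \ B).card = (clF M B).card - B.card := Finset.card_sdiff_of_subset (subset_clF_self hBg)
  rcases Nat.lt_or_ge (jB M B) 1 with hj0 | hj1
  · have hj : jB M B = 0 := by omega
    rw [hj]
    apply max_le (by norm_num)
    have hrpos : (0 : ℚ) < (crk M S : ℚ) + 1 - ((0 : ℕ) : ℚ) := by
      have : (0 : ℚ) ≤ (crk M S : ℚ) := Nat.cast_nonneg _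
      push_cast; linarith
    rw [div_le_iff₀ hrpos]
    push_cast
    linarith
  · have hT1 : 1 ≤ (clF M B \ B).card := by unfold jB at hj1; omega
    obtain ⟨z, hz⟩ := Finset.card_pos.1 hT1
    rcases Nat.lt_or_ge (jB M B) 2 with hj1' | hj2'
    · have hj : jB M B = 1 := by omega
      have hr2 : 2 ≤ crk M S :=
        two_le_crk_of_mem_clF_notMem' hR hsimple hB2 hsub (Finset.mem_sdiff.1 hz).1 (hLS z hz)
      rw [hj]
      apply max_le (by norm_num)
      have hr2q : (2 : ℚ) ≤ (crk M S : ℚ) := by exact_mod_cast hr2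
      have hrpos : (0 : ℚ) < (crk M S : ℚ) + 1 - ((1 : ℕ) : ℚ) := by push_cast; linarith
      rw [div_le_iff₀ hrpos]
      push_cast
      linarith
    · have hj : jB M B = 2 := by omega
      have hT2 : 2 ≤ (clF M B \ B).card := by unfold jB at hj2'; omega
      obtain ⟨z', hz', hzz'⟩ : ∃ z' ∈ clF M B \ B, z' ≠ z := by
        by_contra hcon
        push Not at hcon
        have : clF M B \ B ⊆ {z} := fun w hw => Finset.mem_singleton.2 (hcon w hw)
        have := Finset.card_le_card this
        rw [Finset.card_singleton] at this
        omega
      have hr3 : 3 ≤ crk M S :=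
        three_le_crk_of_two_mem_clF_notMem' hR hsimple hB2 hsub hzz' (Finset.mem_sdiff.1 hz').1
          (Finset.mem_sdiff.1 hz).1 (hLS z' hz') (hLS z hz)
      rw [hj]
      apply max_le (by norm_num)
      have hr3q : (3 : ℚ) ≤ (crk M S : ℚ) := by exact_mod_cast hr3
      have hrpos : (0 : ℚ) < (crk M S : ℚ) + 1 - ((2 : ℕ) : ℚ) := by push_cast; linarith
      rw [div_le_iff₀ hrpos]
      push_cast
      linarith

/-- **(Cap)(d) in every rank `≥ 4`**: a rank-`3` set with at least five points pays at most `3`. -/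
theorem cap_wgn_of_five_le_card (hR : (4 : ℕ∞) ≤ M.eRank) (hsimple : ∀ T ⊆ M.E, T.encard ≤ 2 → M.Indep T)
    {S : Finset α} (hS : S ∈ Shadow.levelSet M 3) (hS5 : 5 ≤ S.card) :
    ∑ B ∈ (Profile.Rq M 2).filter (fun B => B ⊆ S), wgn M B S ≤ 3 := by
  classical
  set Φ := (Profile.Rq M 2).filter (fun B => B ⊆ S) with hΦ
  have hSg : S ⊆ gr M := (Profile.mem_levelSet.1 hS).1
  have hS3 : M.eRk (S : Set α) = 3 := (Profile.mem_levelSet.1 hS).2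
  have hzero : ∀ B ∈ Φ, ¬ (S \ B).card = 1 → wgn M B S = 0 := by
    intro B hB hne
    have hBS : B ⊆ S := (Finset.mem_filter.1 hB).2
    have hBne : B ≠ S := ne_of_mem_filter_levelSet hS hB
    have hcard : (S \ B).card = S.card - B.card := Finset.card_sdiff_of_subset hBS
    have hBle : B.card ≤ S.card := Finset.card_le_card hBS
    have hpos : 0 < (S \ B).card := by
      rw [Finset.card_pos]
      by_contra hemp
      rw [Finset.not_nonempty_iff_eq_empty, Finset.sdiff_eq_empty_iff_subset] at hemp
      exact hBne (Finset.Subset.antisymm hBS hemp)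
    rcases Nat.lt_or_ge (S \ B).card 3 with hlt | hge
    · have he2 : (S \ B).card = 2 := by omega
      exact wgn_eq_zero_of_sdiff_card_two_of_card_ne_two he2 (by omega)
    · exact wgn_eq_zero_of_three_le_sdiff_card hge
  have huniq : (Φ.filter (fun B => (S \ B).card = 1)).card ≤ 1 := by
    rw [Finset.card_le_one]
    intro B hB B' hB'
    rw [Finset.mem_filter] at hB hB'
    obtain ⟨y, hy⟩ := Finset.card_eq_one.1 hB.2
    obtain ⟨y', hy'⟩ := Finset.card_eq_one.1 hB'.2
    have hBS : B ⊆ S := (Finset.mem_filter.1 hB.1).2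
    have hB'S : B' ⊆ S := (Finset.mem_filter.1 hB'.1).2
    have hB2 : M.eRk (B : Set α) = 2 := (Profile.mem_Rq.1 (Finset.mem_filter.1 hB.1).1).2
    have hB'2 : M.eRk (B' : Set α) = 2 := (Profile.mem_Rq.1 (Finset.mem_filter.1 hB'.1).1).2
    have hyS : y ∈ S := by
      have : y ∈ S \ B := by rw [hy]; exact Finset.mem_singleton_self y
      exact (Finset.mem_sdiff.1 this).1
    have hy'S : y' ∈ S := by
      have : y' ∈ S \ B' := by rw [hy']; exact Finset.mem_singleton_self y'
      exact (Finset.mem_sdiff.1 this).1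
    have herase : ∀ {C : Finset α} {w : α}, C ⊆ S → S \ C = {w} → C = S.erase w := by
      intro C w hCS hw
      ext x
      rw [Finset.mem_erase]
      constructor
      · intro hx
        refine ⟨?_, hCS hx⟩
        rintro rfl
        have : x ∈ S \ C := by rw [hw]; exact Finset.mem_singleton_self x
        exact (Finset.mem_sdiff.1 this).2 hx
      · rintro ⟨hxw, hxS⟩
        by_contra hxC
        have : x ∈ S \ C := Finset.mem_sdiff.2 ⟨hxS, hxC⟩
        rw [hw, Finset.mem_singleton] at this
        exact hxw this
    have hBe := herase hBS hy
    have hB'e := herase hB'S hy'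
    rw [hBe] at hB2
    rw [hB'e] at hB'2
    have := eq_of_erase_eRk_two hsimple hSg hS3 hS5 hyS hy'S hB2 hB'2
    rw [hBe, hB'e, this]
  have hbound : ∀ B ∈ Φ.filter (fun B => (S \ B).card = 1), wgn M B S ≤ 2 := by
    intro B hB
    rw [Finset.mem_filter] at hB
    obtain ⟨y, hy⟩ := Finset.card_eq_one.1 hB.2
    have hBS : B ⊆ S := (Finset.mem_filter.1 hB.1).2
    have hB3 : 3 ≤ B.card := by
      have := Finset.card_sdiff_of_subset hBS
      rw [hB.2] at this
      omega
    exact wgn_le_two_of_sdiff_singleton hR hsimple hS (Finset.mem_filter.1 hB.1).1 hBS hB3 hy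
  calc ∑ B ∈ Φ, wgn M B S
      = ∑ B ∈ Φ.filter (fun B => (S \ B).card = 1), wgn M B S +
          ∑ B ∈ Φ.filter (fun B => ¬ (S \ B).card = 1), wgn M B S :=
        (Finset.sum_filter_add_sum_filter_not _ _ _).symm
    _ ≤ ∑ _B ∈ Φ.filter (fun B => (S \ B).card = 1), (2 : ℚ) + 0 := by
        apply add_le_add (Finset.sum_le_sum hbound)
        apply le_of_eq
        apply Finset.sum_eq_zero
        intro B hB
        rw [Finset.mem_filter] at hB
        exact hzero B hB.1 hB.2
    _ = ((Φ.filter (fun B => (S \ B).card = 1)).card : ℚ) * 2 := by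
        rw [Finset.sum_const, nsmul_eq_mul, add_zero]
    _ ≤ 1 * 2 := by
        apply mul_le_mul_of_nonneg_right _ (by norm_num)
        exact_mod_cast huniq
    _ ≤ 3 := by norm_num

end GenGeom

end PercRepro
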